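import Mathlib
import HarnessLib
import Literature.AlgebraicGeometry.Resolution.MarkedIdealsLemmas
import Summits.ResolutionOfSingularities.ResolutionOfSingularities.Theorems.WildQuotientsWildQuotientResolutionS1aBlowupIdleChart
import Summits.ResolutionOfSingularities.ResolutionOfSingularities.Theorems.WildQuotientsWildQuotientResolutionS1aBlowupChartStable
import Summits.ResolutionOfSingularities.ResolutionOfSingularities.Theorems.WildQuotientsWildQuotientResolutionS1aBlowupChartCover
import Summits.ResolutionOfSingularities.ResolutionOfSingularities.Theorems.WildQuotientsWildQuotientResolutionS1aBlowupChartRing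
import Summits.ResolutionOfSingularities.ResolutionOfSingularities.Theorems.WildQuotientsWildQuotientResolutionS1aBlowupChartAway
import Summits.ResolutionOfSingularities.ResolutionOfSingularities.Theorems.WildQuotientsWildQuotientResolutionS1aChartNodeData
import Summits.ResolutionOfSingularities.ResolutionOfSingularities.Theorems.WildQuotientsWildQuotientResolutionS1aCoverNormalisation
import Summits.ResolutionOfSingularities.ResolutionOfSingularities.Theorems.WildQuotientsWildQuotientResolutionS1aCoverTransfer
import Summits.ResolutionOfSingularities.ResolutionOfSingularities.Theorems.WildQuotientsWildQuotientResolutionS1aSigmaNormCover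
import Summits.ResolutionOfSingularities.ResolutionOfSingularities.Theorems.WildQuotientsWildQuotientResolutionBlowupExitIsBlowupPow

/-!
# S1a — H4c DISCHARGED: the blow-up of an admissible centre carries a node atlas (`BlowupNodeAtlas p`, `0 < p`)

[OURS · L1 W4.5c · lead-1 g6] — NOT a statement of the manuscript; counted 0; AI-level work, weaker than expert
review. Crux stmt-ResolutionOfSingularities-17941 (`WildQuotients.CyclicQuotientFourfolds`), line `s1a-logminvertex`,
stub `stub_localGame` (producer FRAME); A5b design `Cruxes/CyclicQuotientFourfolds/Lines/s1a-logminvertex-A5B-DESIGN.md`,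
plan-1 RULING 22:26:15Z («prove `blowupNodeAtlas_of_pos (hp : 0 < p)` externally; no edit of landed binders»).

**`blowupNodeAtlas_of_pos`**: for `0 < p`, H4c `MoveStep.BlowupNodeAtlas p` HOLDS — the blow-up `V' = Bl_{𝒦 d} V` of an
admissible centre, with the LIFTED cyclic action, is again covered by node charts. Assembly of the landed pieces:

* idle charts — `exists_isNodeChart_preimage_of_isIdleChart` (S4);
* centre charts — `exists_isNodeChart_of_isCentreChart` (this file): on a centre chart `O` with node `(B, 𝒜, σ, e)` and
  centre `(f, w)`, take the σ-invariant normalised cover `y_j ∈ K_{d̄}`, `d̄ = d k` (`exists_normalised_cover` fed by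
  `coverClause_of_sigma_norms`); `π` is a blow-up of `(𝒦 d)^k` (`isBlowup_pow`) whose sections over `O` are `e⁻¹ K_{d̄}`
  (Veronese); the intrinsic principal charts `W_j = V'[O, e⁻¹ y_j]` cover `π⁻¹ O` (`IsBlowup.iSup_blowupChart_of_radical`
  + `reesT_mem_radical_span` + `reesT_mem_radical_span_of_equiv`), are `G`-stable (`preimage_blowupChart_eq`, the `y_j`
  being `σ`-fixed and `G = ⟨g₀⟩`), affine and affine over `Y`, and `Γ(V', W_j) ≅ (Rees K_{d̄})_{(y_j t)} ≅ 𝒜ʼ 0`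
  (`exists_ringEquiv_blowupChart`, `awayEquiv`, `exists_chartNodeData`) intertwines `g₀` with `σʼ = sigmaChart`
  (rigidity `away_ringHom_ext` + naturality `appLE_lift_comm_of_le` + the pins).

Consequence: in H4c `MoveStep p` / `moveStep_of` and in `GameFrameWF.killTameModel_of_blowupNodeAtlas_wf` the hypothesis
`BlowupNodeAtlas p` is discharged for every prime `p` (`blowupNodeAtlas_of_prime`).
-/

set_option linter.dupNamespace false

noncomputable section

open CategoryTheory AlgebraicGeometry TopologicalSpace Polynomial
open Literature.AlgebraicGeometry.Resolution Literature.AlgebraicGeometry.RelativeSpec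
open Summit.ResolutionOfSingularities.ResolutionOfSingularities.Theorems.WildQuotientResolution.S1
open Summit.ResolutionOfSingularities.ResolutionOfSingularities.Theorems.WildQuotientResolution.S1.ProducerStep
open Summit.ResolutionOfSingularities.ResolutionOfSingularities.Theorems.WildQuotientResolution.S1.CoarseChart
open Summit.ResolutionOfSingularities.ResolutionOfSingularities.Theorems.WildQuotientResolution.S1.NodeAtlas
open Summit.ResolutionOfSingularities.ResolutionOfSingularities.Theorems.WildQuotientResolution.S1.MoveStep
open Summit.ResolutionOfSingularities.ResolutionOfSingularities.Theorems.WildQuotientResolution.BlowupExit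

namespace Summit.ResolutionOfSingularities.ResolutionOfSingularities.Theorems.WildQuotientResolution.S1.BlowupCharts

universe u v

/-! ## Small algebra -/

section Algebra

/-- A multiple of a Veronese degree is a Veronese degree. -/
theorem veroneseNormalised_mul {ι : Type v} [AddCommGroup ι] [DecidableEq ι] {B : Type u} [CommRing B]
    (𝒜 : ι → AddSubgroup B) [GradedRing 𝒜] {c : ℕ} (f : Fin c → B) (w : Fin c → ℕ) {d : ℕ}
    (h : VeroneseNormalised 𝒜 f w d) {k : ℕ} (hk : 0 < k) : VeroneseNormalised 𝒜 f w (d * k) :=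
  ⟨Nat.mul_pos h.1 hk, fun l => by rw [mul_assoc, h.2 (k * l), pow_mul, ← h.2 k]⟩

/-- Contraction along a ring isomorphism commutes with powers of ideals. -/
theorem comap_equiv_pow {R S : Type u} [CommRing R] [CommRing S] (e : R ≃+* S) (K : Ideal S) (k : ℕ) :
    (K ^ k).comap (e : R →+* S) = K.comap (e : R →+* S) ^ k := by
  rw [Ideal.comap_coe, Ideal.comap_coe, ← Ideal.map_symm, ← Ideal.map_symm, Ideal.map_pow]

/-- **`b ↦ b/1 ∈ R^w[(b T^d)⁻¹]` is a non-zero-divisor**: `b = (b T^d) · (T⁻¹)^d` with `b T^d` a unit of the chart ring and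
`T⁻¹` a non-zero-divisor of `R^w ⊆ B[T;T⁻¹]`, hence of the localization. -/
theorem toChartRing_self_mem_nonZeroDivisors {ι : Type v} [AddCommGroup ι] [DecidableEq ι] {B : Type u} [CommRing B]
    (𝒜 : ι → AddSubgroup B) [GradedRing 𝒜] {c : ℕ} (f : Fin c → B) (w : Fin c → ℕ) (d : ℕ) (b : ↥(𝒜 0))
    (hb : b ∈ (traceFiltration 𝒜 f w).ideal d) :
    toChartRing 𝒜 f w d b hb b ∈ nonZeroDivisors (ChartRing 𝒜 f w d b hb) := by
  have hfac : algebraMap B (↥(cobordantAlgebra f w)) (b : B) =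
      coverElement 𝒜 f w d b hb * cobordantAlgebra.s f w ^ d := by
    refine Subtype.ext ?_
    rw [cobordantAlgebra.coe_algebraMap, MulMemClass.coe_mul, coe_coverElement, cobordantAlgebra.coe_s_pow, mul_assoc,
      ← LaurentPolynomial.T_add, add_neg_cancel, LaurentPolynomial.T_zero, mul_one]
  have hs : (cobordantAlgebra.s f w : ↥(cobordantAlgebra f w)) ∈ nonZeroDivisors ↥(cobordantAlgebra f w) :=
    mem_nonZeroDivisors_of_injective (f := (cobordantAlgebra f w).val) Subtype.val_injective
      (by rw [Subalgebra.coe_val, cobordantAlgebra.coe_s]; exact (LaurentPolynomial.isUnit_T (-1)).mem_nonZeroDivisors)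
  rw [toChartRing_apply, SetLike.GradeZero.algebraMap_apply, hfac, map_mul, map_pow]
  refine mul_mem (IsLocalization.Away.algebraMap_isUnit (coverElement 𝒜 f w d b hb)).mem_nonZeroDivisors
    (pow_mem ?_ d)
  exact IsLocalization.nonZeroDivisors_le_comap (Submonoid.powers (coverElement 𝒜 f w d b hb))
    (ChartRing 𝒜 f w d b hb) hs

/-- **INTERTWINING, abstract form.** The node side: a tame node `(B, 𝒜, σ)` with centre `(f, w)`, a `σ`-fixed cover
element `b ∈ K_d`; the chart side: abstract rings `R₀ →[πW] C` (sections over `O` and over the chart `W`) with compatible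
actions `act₀`, `act` (naturality `hnat`), the node iso `e : R₀ ≃ 𝒜 0` intertwining `act₀` with `σ` (`hσe`), the chart-ring
iso `Ψ : C ≃ (Rees J')_{(xt)}` pinned on `πW` and the transport `T : (Rees J')_{(xt)} ≃ (Rees K_d)_{(bt)}` pinned on `e`.
Then `coarseChartMap ∘ T ∘ Ψ` intertwines `act` with `σʼ = sigmaChart` — by rigidity of the chart ring over `𝒜 0`
(`away_ringHom_ext`), since both sides agree on `𝒜 0` by the pins. [OURS · L1 W4.5c] -/
theorem intertwine {ι : Type v} [AddCommGroup ι] [DecidableEq ι] {B : Type u} [CommRing B]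
    (𝒜 : ι → AddSubgroup B) [GradedRing 𝒜] {c : ℕ} (f : Fin c → B) (w : Fin c → ℕ) (d : ℕ)
    (b : ↥(𝒜 0)) (hb : b ∈ (traceFiltration 𝒜 f w).ideal d) (σ : B ≃+* B)
    (hσJ : ∀ n : ℕ, ((weightedFiltration f w).ideal n).map (σ : B →+* B) ≤ (weightedFiltration f w).ideal n)
    {p : ℕ} (hp : 0 < p) (hσp : ∀ x : B, (⇑σ)^[p] x = x) (hσb : σ (b : B) = b)
    (hσ𝒜 : ∀ (i : ι) (x : B), x ∈ 𝒜 i → σ x ∈ 𝒜 i)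
    {R₀ C : Type u} [CommRing R₀] [CommRing C] (e : R₀ ≃+* ↥(𝒜 0)) {J' : Ideal R₀} {x : R₀} (hx : x ∈ J')
    (πW : R₀ →+* C) (act : C →+* C) (act₀ : R₀ → R₀) (hnat : ∀ r, act (πW r) = πW (act₀ r))
    (hσe : ∀ r, ((e (act₀ r) : ↥(𝒜 0)) : B) = σ ((e r : ↥(𝒜 0)) : B))
    (Ψ : C ≃+* HomogeneousLocalization.Away (reesGrading J') (reesT x hx))
    (hΨ : ∀ r, Ψ (πW r) = reesChartBase x hx r)
    (T : HomogeneousLocalization.Away (reesGrading J') (reesT x hx) ≃+*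
      HomogeneousLocalization.Away (reesGrading ((traceFiltration 𝒜 f w).ideal d)) (reesT b hb))
    (hT : ∀ r, T (reesChartBase x hx r) = reesChartBase b hb (e r)) (t' : C) :
    coarseChartMap 𝒜 f w d b hb (T (Ψ (act t'))) =
      sigmaChart 𝒜 f w d b hb σ hσJ hp hσp hσb (coarseChartMap 𝒜 f w d b hb (T (Ψ t'))) := by
  -- the two ring maps `(Rees K_d)_{(bt)} → R^w[(bT^d)⁻¹]`
  have hTf' : ∃ F : HomogeneousLocalization.Away (reesGrading J') (reesT x hx) →+*
      HomogeneousLocalization.Away (reesGrading ((traceFiltration 𝒜 f w).ideal d)) (reesT b hb), ∀ u, F u = T u :=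
    ⟨T.toRingHom, fun _ => rfl⟩
  obtain ⟨Tf, hTf⟩ := hTf'
  have hTs' : ∃ F : HomogeneousLocalization.Away (reesGrading ((traceFiltration 𝒜 f w).ideal d)) (reesT b hb) →+*
      HomogeneousLocalization.Away (reesGrading J') (reesT x hx), ∀ u, F u = T.symm u :=
    ⟨T.symm.toRingHom, fun _ => rfl⟩
  obtain ⟨Ts, hTs⟩ := hTs'
  have hΨf' : ∃ F : C →+* HomogeneousLocalization.Away (reesGrading J') (reesT x hx), ∀ u, F u = Ψ u :=
    ⟨Ψ.toRingHom, fun _ => rfl⟩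
  obtain ⟨Ψf, hΨf⟩ := hΨf'
  have hΨs' : ∃ F : HomogeneousLocalization.Away (reesGrading J') (reesT x hx) →+* C, ∀ u, F u = Ψ.symm u :=
    ⟨Ψ.symm.toRingHom, fun _ => rfl⟩
  obtain ⟨Ψs, hΨs⟩ := hΨs'
  have hσf' : ∃ F : ChartRing 𝒜 f w d b hb →+* ChartRing 𝒜 f w d b hb,
      ∀ u, F u = sigmaChart 𝒜 f w d b hb σ hσJ hp hσp hσb u :=
    ⟨(sigmaChart 𝒜 f w d b hb σ hσJ hp hσp hσb).toRingHom, fun _ => rfl⟩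
  obtain ⟨σf, hσf⟩ := hσf'
  have hH₁' : ∃ H₁ : HomogeneousLocalization.Away (reesGrading ((traceFiltration 𝒜 f w).ideal d)) (reesT b hb) →+*
      ChartRing 𝒜 f w d b hb, ∀ u, H₁ u = coarseChartMap 𝒜 f w d b hb (T (Ψ (act (Ψ.symm (T.symm u))))) :=
    ⟨(coarseChartMap 𝒜 f w d b hb).comp (Tf.comp (Ψf.comp (act.comp (Ψs.comp Ts)))), fun u => by
      simp only [RingHom.comp_apply, hTf, hΨf, hΨs, hTs]⟩
  obtain ⟨H₁, hH₁⟩ := hH₁'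
  have hH₂' : ∃ H₂ : HomogeneousLocalization.Away (reesGrading ((traceFiltration 𝒜 f w).ideal d)) (reesT b hb) →+*
      ChartRing 𝒜 f w d b hb, ∀ u, H₂ u = sigmaChart 𝒜 f w d b hb σ hσJ hp hσp hσb (coarseChartMap 𝒜 f w d b hb u) :=
    ⟨σf.comp (coarseChartMap 𝒜 f w d b hb), fun u => by simp only [RingHom.comp_apply, hσf]⟩
  obtain ⟨H₂, hH₂⟩ := hH₂'
  -- they agree on `𝒜 0`
  have hH : ∀ s : ↥(𝒜 0), H₁ (reesChartBase b hb s) = H₂ (reesChartBase b hb s) := by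
    intro s
    have h1 : T.symm (reesChartBase b hb s) = reesChartBase x hx (e.symm s) :=
      T.injective (by rw [T.apply_symm_apply, hT, e.apply_symm_apply])
    have h2 : Ψ.symm (reesChartBase x hx (e.symm s)) = πW (e.symm s) :=
      Ψ.injective (by rw [Ψ.apply_symm_apply, hΨ])
    have h4 : e (act₀ (e.symm s)) = ⟨σ (s : B), hσ𝒜 0 _ s.2⟩ :=
      Subtype.ext (by rw [hσe (e.symm s), e.apply_symm_apply])
    -- (`simp only`, not `rw`: keyed rewriting over these rings exhausts the heartbeat budget)
    simp only [hH₁, hH₂, h1, h2, hnat, hΨ, hT, h4, coarseChartMap_reesChartBase, toChartRing_apply,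
      SetLike.GradeZero.algebraMap_apply, sigmaChart_algebraMap_algebraMap]
  -- and `b/1` goes to a non-zero-divisor
  have hreg : H₁ (reesChartBase b hb b) ∈ nonZeroDivisors (ChartRing 𝒜 f w d b hb) := by
    have := toChartRing_self_mem_nonZeroDivisors 𝒜 f w d b hb
    simp only [toChartRing_apply, SetLike.GradeZero.algebraMap_apply] at this
    simp only [hH, hH₂, coarseChartMap_reesChartBase, toChartRing_apply, SetLike.GradeZero.algebraMap_apply,
      sigmaChart_algebraMap_algebraMap, hσb]
    exact this
  -- rigidity
  have hz' : ∃ z, t' = Ψ.symm (T.symm z) :=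
    ⟨T (Ψ t'), by simp only [T.symm_apply_apply, Ψ.symm_apply_apply]⟩
  obtain ⟨z, hz⟩ := hz'
  subst hz
  have key := RingHom.congr_fun (away_ringHom_ext b hb hreg hH) z
  simp only [hH₁, hH₂, Ψ.apply_symm_apply, T.apply_symm_apply] at key ⊢
  exact key

end Algebra

/-! ## Sections fixed by a cyclic group -/

section Fixed

variable {V Y : Scheme.{u}} {q : V ⟶ Y} {G : Type*} [Group G] (ρ : ActionOver q G) (O : V.Opens)
  (hO : ∀ g : G, (ρ.aut g).hom ⁻¹ᵁ O = O)

/-- `1` acts trivially on `Γ(V, O)`. -/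
theorem appLE_aut_one (b : Γ(V, O)) : (ρ.aut 1).hom.appLE O O (hO 1).ge b = b := by
  have h1 : (ρ.aut 1).hom = 𝟙 V := by rw [map_one]; rfl
  rw [appLE_congr_of_eq h1 O O (hO 1).ge le_rfl]
  exact id_appLE_apply O le_rfl b

/-- `g h` acts on `Γ(V, O)` as `h^* ∘ g^*` … i.e. pulling back along `g` first. -/
theorem appLE_aut_mul (g h : G) (b : Γ(V, O)) :
    (ρ.aut (g * h)).hom.appLE O O (hO _).ge b = (ρ.aut h).hom.appLE O O (hO h).ge ((ρ.aut g).hom.appLE O O (hO g).ge b) := by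
  have hgh : (ρ.aut (g * h)).hom = (ρ.aut h).hom ≫ (ρ.aut g).hom := by rw [map_mul, Aut.Aut_mul_def]; rfl
  have hle : O ≤ ((ρ.aut h).hom ≫ (ρ.aut g).hom) ⁻¹ᵁ O := by
    rw [Scheme.Hom.comp_preimage, hO g, hO h]
  rw [appLE_congr_of_eq hgh O O (hO _).ge hle, ← Scheme.Hom.appLE_comp_appLE _ _ O O O (hO g).ge (hO h).ge]
  rfl

/-- A section fixed by `g` is fixed by `g⁻¹`. -/
theorem appLE_aut_inv_eq_self {g : G} {b : Γ(V, O)} (hb : (ρ.aut g).hom.appLE O O (hO g).ge b = b) :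
    (ρ.aut g⁻¹).hom.appLE O O (hO g⁻¹).ge b = b := by
  have := appLE_aut_mul ρ O hO g g⁻¹ b
  rw [hb] at this
  rw [← this]
  have h1 := appLE_aut_one ρ O hO b
  rw [← mul_inv_cancel g] at h1
  exact h1

/-- **A section fixed by `g₀` is fixed by every element of `⟨g₀⟩`.** -/
theorem appLE_aut_eq_self_of_mem_zpowers {g₀ : G} {b : Γ(V, O)} (hb : (ρ.aut g₀).hom.appLE O O (hO g₀).ge b = b)
    {g : G} (hg : g ∈ Subgroup.zpowers g₀) : (ρ.aut g).hom.appLE O O (hO g).ge b = b := by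
  rw [Subgroup.zpowers_eq_closure] at hg
  induction hg using Subgroup.closure_induction with
  | mem x hx => rw [Set.mem_singleton_iff] at hx; subst hx; exact hb
  | one => exact appLE_aut_one ρ O hO b
  | mul x y _ _ hx hy => rw [appLE_aut_mul ρ O hO x y b, hx, hy]
  | inv x _ hx => exact appLE_aut_inv_eq_self ρ O hO hx

end Fixed

/-! ## Centre charts lift to node charts of the blow-up -/

section Centre

variable {V' V Y : Scheme.{u}} {π : V' ⟶ V} {q : V ⟶ Y} {I : V.IdealSheafData} {G : Type u} [Group G]
  (ρ : ActionOver q G) (hπ : IsBlowup π I) (hρ : ∀ g : G, I.comap (ρ.aut g).hom = I) {p : ℕ} (g₀ : G)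

/-- **(S1–S3, S5) A CENTRE chart lifts**: every point of `π⁻¹ O` over a centre chart `O` of the admissible centre lies in
a node chart of `V'` for the lifted action. [OURS · L1 W4.5c] -/
theorem exists_isNodeChart_of_isCentreChart (hp : 0 < p) (hG : ∀ g : G, g ∈ Subgroup.zpowers g₀)
    (𝒦 : ReesFiltration V) (d : ℕ) (hI : I = 𝒦.ideal d)
    (O : ρ.StableAffineOpens) (hcentre : IsCentreChart p ρ g₀ 𝒦 d O) (v' : V') (hv' : π.base v' ∈ O.1) :
    ∃ O' : (liftActionOver ρ hπ hρ).StableAffineOpens, v' ∈ O'.1 ∧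
      IsNodeChart p (liftActionOver ρ hπ hρ) g₀ O' := by
  classical
  obtain ⟨hO, m, r, B, _, 𝒜, _, σ, e, htame, hσ, c, f, δ, w, -, hf, hw, hK1, hK1', hσJ, h𝒦O, hver⟩ := hcentre
  obtain ⟨-, -, hT1, -, hσ𝒜, hσp⟩ := id htame
  -- Step 1: a σ-invariant normalised cover, of Veronese degree `dbar = d * k`
  obtain ⟨dbar, hdbar, ⟨k, hk⟩, L, y, hy, hσy, hrad⟩ :=
    exists_normalised_cover 𝒜 f w σ hp hσ𝒜 hσp hT1 (coverClause_of_sigma_norms 𝒜 σ p hp hσ𝒜 hσp f δ w hf hw hσJ)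
      d hver.1
  have hk0 : k ≠ 0 := by rintro rfl; rw [mul_zero] at hk; exact hdbar.ne' hk
  have hverbar : VeroneseNormalised 𝒜 f w dbar := by
    rw [hk]; exact veroneseNormalised_mul 𝒜 f w hver (Nat.pos_of_ne_zero hk0)
  -- Step 2: `π` blows up `I ^ k`, whose sections over `O` are `e⁻¹ K_{dbar}`
  have hπ' : IsBlowup π (I ^ k) := isBlowup_pow hπ hk0
  have hJ' : (I ^ k).ideal ⟨O.1, hO⟩ =
      ((traceFiltration 𝒜 f w).ideal dbar).comap (e : Γ(V, O.1) →+* ↥(𝒜 0)) := by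
    rw [Scheme.IdealSheafData.ideal_pow, Pi.pow_apply, hI, ← ReesFiltration.filtration_ideal, h𝒦O d, hk, hver.2 k,
      comap_equiv_pow]
  -- Step 3: the sections `e⁻¹ y_j`
  have hb : ∀ j, e.symm (y j) ∈ (I ^ k).ideal ⟨O.1, hO⟩ := fun j => by
    rw [hJ', Ideal.mem_comap, RingHom.coe_coe, e.apply_symm_apply]; exact hy j
  -- Step 4: the principal charts `V'[O, e⁻¹ y_j]` cover `π⁻¹ O`
  have hradO : ∀ (b' : Γ(V, O.1)) (hb' : b' ∈ (I ^ k).ideal ⟨O.1, hO⟩),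
      reesT b' hb' ∈ (Ideal.span (Set.range fun j => reesT (e.symm (y j)) (hb j))).radical := by
    intro b' hb'
    have hx : e b' ∈ (traceFiltration 𝒜 f w).ideal dbar := by
      rw [hJ', Ideal.mem_comap] at hb'; exact hb'
    have h1 := reesT_mem_radical_span 𝒜 f w dbar y hy hf hverbar hrad (e b') hx
    have hJle : ((traceFiltration 𝒜 f w).ideal dbar).map (e.symm : ↥(𝒜 0) →+* Γ(V, O.1)) ≤
        (I ^ k).ideal ⟨O.1, hO⟩ := by
      rw [Ideal.map_coe, hJ', Ideal.comap_coe, Ideal.map_symm]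
    have hb'' : e.symm (e b') ∈ (I ^ k).ideal ⟨O.1, hO⟩ := by rw [e.symm_apply_apply]; exact hb'
    have h2 := reesT_mem_radical_span_of_equiv e ((I ^ k).ideal ⟨O.1, hO⟩) ((traceFiltration 𝒜 f w).ideal dbar)
      hJle y hy hb (e b') hx hb'' h1
    have key : ∀ (a : Γ(V, O.1)) (ha : a ∈ (I ^ k).ideal ⟨O.1, hO⟩), a = b' →
        reesT a ha ∈ (Ideal.span (Set.range fun j => reesT (e.symm (y j)) (hb j))).radical →
        reesT b' hb' ∈ (Ideal.span (Set.range fun j => reesT (e.symm (y j)) (hb j))).radical := by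
      rintro _ _ rfl h; exact h
    exact key _ hb'' (e.symm_apply_apply b') h2
  have hcovW : ⨆ j, blowupChart π (I ^ k) ⟨O.1, hO⟩ (e.symm (y j)) = π ⁻¹ᵁ O.1 :=
    IsBlowup.iSup_blowupChart_of_radical hπ' (U := ⟨O.1, hO⟩) (fun j => e.symm (y j)) hb hradO
  -- Step 5: locate `v'`
  have hv'W : v' ∈ ⨆ j, blowupChart π (I ^ k) ⟨O.1, hO⟩ (e.symm (y j)) := by rw [hcovW]; exact hv'
  obtain ⟨j, hj⟩ := Opens.mem_iSup.mp hv'W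
  -- Step 6: the chart `W = V'[O, x]`, `x = e⁻¹ y_j`
  have hxJ : e.symm (y j) ∈ (I ^ k).ideal ⟨O.1, hO⟩ := hb j
  have hxy : e (e.symm (y j)) = y j := e.apply_symm_apply (y j)
  have hWaff : IsAffineOpen (blowupChart π (I ^ k) ⟨O.1, hO⟩ (e.symm (y j))) := hπ'.isAffineOpen_blowupChart (hb j)
  have hWle : blowupChart π (I ^ k) ⟨O.1, hO⟩ (e.symm (y j)) ≤ π ⁻¹ᵁ O.1 :=
    blowupChart_le_preimage π (I ^ k) ⟨O.1, hO⟩ (e.symm (y j))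
  -- `x` is fixed by `G = ⟨g₀⟩`
  have hfix₀ : (ρ.aut g₀⁻¹).hom.appLE O.1 O.1 (O.2.1 g₀⁻¹).ge (e.symm (y j)) = e.symm (y j) := by
    apply e.injective
    apply Subtype.ext
    rw [hσ (e.symm (y j)), hxy]
    exact hσy j
  have hfix : ∀ g : G, (ρ.aut g).hom.appLE O.1 O.1 (O.2.1 g).ge (e.symm (y j)) = e.symm (y j) := fun g =>
    appLE_aut_eq_self_of_mem_zpowers ρ O.1 O.2.1 hfix₀ (by rw [Subgroup.zpowers_inv]; exact hG g)
  have hstabW : ∀ g : G, ((liftActionOver ρ hπ hρ).aut g).hom ⁻¹ᵁ blowupChart π (I ^ k) ⟨O.1, hO⟩ (e.symm (y j)) =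
      blowupChart π (I ^ k) ⟨O.1, hO⟩ (e.symm (y j)) := fun g =>
    preimage_blowupChart_eq ((liftActionOver ρ hπ hρ).aut g) (ρ.aut g) (liftActionOver_aut_hom_comp ρ hπ hρ g)
      (O.2.1 g) (by rw [comap_pow, hρ g]) (hfix g)
  -- affine over `Y`
  haveI : IsAffineHom ((blowupChart π (I ^ k) ⟨O.1, hO⟩ (e.symm (y j))).ι ≫ π ≫ q) := by
    haveI : IsAffine (blowupChart π (I ^ k) ⟨O.1, hO⟩ (e.symm (y j)) : V'.Opens) := hWaff
    haveI : IsAffine (O.1 : V.Opens) := hO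
    haveI := O.2.2
    have : (blowupChart π (I ^ k) ⟨O.1, hO⟩ (e.symm (y j))).ι ≫ π ≫ q =
        π.resLE O.1 (blowupChart π (I ^ k) ⟨O.1, hO⟩ (e.symm (y j))) hWle ≫ (O.1.ι ≫ q) := by
      rw [← Category.assoc, ← Scheme.Hom.resLE_comp_ι π hWle, Category.assoc]
    rw [this]
    infer_instance
  let O' : (liftActionOver ρ hπ hρ).StableAffineOpens := ⟨blowupChart π (I ^ k) ⟨O.1, hO⟩ (e.symm (y j)), hstabW, inferInstance⟩
  refine ⟨O', hj, hWaff, ?_⟩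
  -- Step 7: the node data of the chart ring
  obtain ⟨Ψ, hΨ⟩ := exists_ringEquiv_blowupChart hπ' ⟨O.1, hO⟩ (e.symm (y j)) hxJ
  obtain ⟨𝒜', _, e', htame', he'⟩ :=
    exists_chartNodeData r 𝒜 f w hf dbar (y j) (hy j) σ hσJ hp hσp (hσy j) htame hw hK1 hK1' hverbar
  obtain ⟨T, hT⟩ : ∃ T : HomogeneousLocalization.Away (reesGrading ((I ^ k).ideal ⟨O.1, hO⟩)) (reesT (e.symm (y j)) hxJ) ≃+*
      HomogeneousLocalization.Away (reesGrading ((traceFiltration 𝒜 f w).ideal dbar)) (reesT (y j) (hy j)),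
      ∀ s, T (reesChartBase (e.symm (y j)) hxJ s) = reesChartBase (y j) (hy j) (e s) :=
    ⟨awayEquiv e hJ' hxJ (hy j) hxy, awayEquiv_reesChartBase e hJ' hxJ (hy j) hxy⟩
  refine ⟨m + 1, (Fin.cons 0 r : Fin (m + 1) → ℕ), ChartRing 𝒜 f w dbar (y j) (hy j), inferInstance, 𝒜', inferInstance,
    sigmaChart 𝒜 f w dbar (y j) (hy j) σ hσJ hp hσp (hσy j), (Ψ.trans T).trans e', htame', fun t' => ?_⟩
  -- Step 8: the intertwining (`intertwine`, fed with the pins)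
  have hE : ∀ u, ((((Ψ.trans T).trans e') u : ↥(𝒜' 0)) : ChartRing 𝒜 f w dbar (y j) (hy j)) =
      coarseChartMap 𝒜 f w dbar (y j) (hy j) (T (Ψ u)) := fun u => he' (T (Ψ u))
  refine (hE _).trans (Eq.trans ?_ (congrArg (sigmaChart 𝒜 f w dbar (y j) (hy j) σ hσJ hp hσp (hσy j)) (hE t').symm))
  exact intertwine 𝒜 f w dbar (y j) (hy j) σ hσJ hp hσp (hσy j) hσ𝒜 e hxJ
    (π.appLE ((⟨O.1, hO⟩ : V.affineOpens) : V.Opens) (blowupChart π (I ^ k) ⟨O.1, hO⟩ (e.symm (y j)))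
      (blowupChart_le_preimage π (I ^ k) ⟨O.1, hO⟩ (e.symm (y j)))).hom
    (((liftActionOver ρ hπ hρ).aut g₀⁻¹).hom.appLE (blowupChart π (I ^ k) ⟨O.1, hO⟩ (e.symm (y j)))
      (blowupChart π (I ^ k) ⟨O.1, hO⟩ (e.symm (y j))) (hstabW g₀⁻¹).ge).hom
    (fun r => (ρ.aut g₀⁻¹).hom.appLE O.1 O.1 (O.2.1 g₀⁻¹).ge r)
    (fun r => appLE_lift_comm_of_le ρ hπ hρ ((⟨O.1, hO⟩ : V.affineOpens) : V.Opens) O.2.1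
      (blowupChart π (I ^ k) ⟨O.1, hO⟩ (e.symm (y j))) hstabW
      (blowupChart_le_preimage π (I ^ k) ⟨O.1, hO⟩ (e.symm (y j))) g₀⁻¹ r)
    hσ Ψ hΨ T hT t'

end Centre

/-! ## H4c discharged -/

section Atlas

/-- **H4c `BlowupNodeAtlas p` HOLDS for `0 < p`**: the blow-up of an admissible centre, with the lifted cyclic action,
carries a node atlas. [OURS · L1 W4.5c] -/
theorem blowupNodeAtlas_of_pos {p : ℕ} (hp : 0 < p) : MoveStep.BlowupNodeAtlas.{u} p := by
  intro V Y q G _ ρ g₀ hG 𝒦 d h𝒦 V' π hπ v'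
  obtain ⟨O, hvO, hO⟩ := h𝒦.2.2 (π.base v')
  rcases hO with hc | hi
  · exact exists_isNodeChart_of_isCentreChart ρ hπ (comap_aut_eq_of_isAdmissibleCentre h𝒦) g₀ hp hG 𝒦 d rfl O hc
      v' hvO
  · obtain ⟨O', hO', hnode⟩ :=
      exists_isNodeChart_preimage_of_isIdleChart ρ hπ (comap_aut_eq_of_isAdmissibleCentre h𝒦) g₀ 𝒦 d rfl O hi
    refine ⟨O', ?_, hnode⟩
    rw [hO']
    exact hvO

/-- **H4c for primes.** -/
theorem blowupNodeAtlas_of_prime {p : ℕ} (hp : p.Prime) : MoveStep.BlowupNodeAtlas.{u} p :=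
  blowupNodeAtlas_of_pos hp.pos

end Atlas

end Summit.ResolutionOfSingularities.ResolutionOfSingularities.Theorems.WildQuotientResolution.S1.BlowupCharts

end
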